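import Literature.AlgebraicGeometry.Morphisms.FpqcDescentOfMorphisms
import Mathlib.AlgebraicGeometry.PullbackCarrier
import Mathlib.AlgebraicGeometry.Morphisms.UniversallyClosed
import HarnessLib

/-!
# The quotient by a free action with an fppf torsor square is a CATEGORICAL quotient; saturated opens descend
# ([MumfordAV1970] §12 Thm. 1 proof; [SGA3I] Exp. V §4–§5; [StacksProject] Tag 02VW ∕ 023Q)

Topic `Literature/AlgebraicGeometry/RelativeSpec`; namespace `Literature.AlgebraicGeometry.RelativeSpec.TorsorQuotient`.  THEOREMS ONLY (no definition, no
named fact, no instance, no notation, no `sorry`).  Cell `hodgecm-mathlib` (D-0151 ∕ D-0183 FLOOR 0), P6b «σ2» socket §Q `stub_L4B1uQ_quotientByFiniteFlatSubgroup`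
(quotient of an abelian scheme by a finite flat subgroup), wave-B organs Q5a ∕ Q5b of the CENSUS-Q-junction (LH10-p01 (g17)); prover LA1-p02 (g10).  Generic,
count-neutral capital on `--supports stmt-HodgeConjecture-24832`; HC_CM is proved only modulo the printed citations until rung 0 closes; nothing here is about HC.

THE PRINT.  [MumfordAV1970] §12, proof of Thm. 1 (pp. 111–115) and [SGA3I] Exp. V Thm. 4.1: for a free action of a finite flat group scheme `G` on an affine `X`, the
map `q : X → X⧸G = Spec (𝒪(X)^G)` is finite, faithfully flat, and `G × X ≅ X ×_{X⧸G} X` (the TORSOR SQUARE); hence ([SGA1] VIII ∕ [StacksProject] Tag 023Q, fpqc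
descent of morphisms) `q` is a universal effective epimorphism whose kernel pair is `G × X ⇉ X`: a morphism `f : X → W` with `f ∘ act = f ∘ pr₂` FACTORS UNIQUELY
through `q` — `q` is a CATEGORICAL QUOTIENT.  For a `G`-stable open `W ⊆ X` the image `q(W)` is open with `q⁻¹(q(W)) = W` ([MumfordAV1970] p. 112: the fibres of
`q` are the orbits), so the quotient of `W` is the open `q(W)` — the gluing step of [SGA3I] V §5.

ABSTRACT FORM typed here (so that the §Q junction feeds it its own realisation of the torsor square, chart by chart or globally): `S` any scheme, `P O Q : Over S`,
two maps `act pr₂ : P ⟶ O`, `q : O ⟶ Q` with `q.left` flat, surjective, quasi-compact and the square `IsPullback act.left pr₂.left q.left q.left` on underlying schemes.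
* §1 `existsUnique_desc_of_isPullback` (Q5a) — every `f : O ⟶ W` over `S` with `act ≫ f = pr₂ ≫ f` descends UNIQUELY along `q` (★ `Morphisms/FpqcDescentOfMorphisms.existsUnique_desc_of_pullback_comp_eq`
  on underlying schemes; the descended map is over `S` because `q.left` is epi); `hom_ext` — morphisms out of `Q` are determined after `q`.
* §2 (Q5b) `preimage_image_eq_of_stable` — for `W ⊆ O` open and STABLE (`act⁻¹ W = pr₂⁻¹ W`), `q⁻¹(q(W)) = W` (points of `O ×_Q O` come from points of `P`, Mathlib
  `Scheme.Pullback.exists_preimage_pullback`); `isOpen_image_of_stable` — `q(W)` is open when `q.left` is universally closed (e.g. finite): `q(W) = Q ∖ q(O ∖ W)`.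

* §3 (ED. 2) `isPullback_resLE_of_isPullback` — the torsor square RESTRICTS over any open `U ⊆ Q` (Mathlib `Scheme.Hom.isPullback_resLE`), `preimage_imageOpens_eq_of_stable`
  (`q⁻¹ᵁ (q(W)) = W` as opens), `exists_opens_quotient_of_stable` (package: «`W → q(W)` is again an fppf torsor quotient»).

NOT here: the locally-directed gluing of the affine quotients (census Q5c) — the consumer, ★-to-be `TorsorQuotientGluing` (LH6-p04).

## References
* [MumfordAV1970] D. Mumford, *Abelian Varieties* (1970), §12 Thm. 1 and its proof (pp. 111–115); §7 Thm. 4 (p. 72).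
* [SGA3I] M. Demazure, A. Grothendieck, *SGA 3* Tome I (LNM 151), Exp. V §4 Thm. 4.1, §5.
* [StacksProject] The Stacks Project, Tag 02VW (fpqc coverings are universal effective epimorphisms), Tag 023Q (descent of morphisms).
* [GortzWedhorn2020] U. Görtz, T. Wedhorn, *Algebraic Geometry I* (2nd ed., 2020), Thm. 14.72, Prop. 14.9.
-/

noncomputable section

universe u

open CategoryTheory CategoryTheory.Limits AlgebraicGeometry

namespace Literature.AlgebraicGeometry.RelativeSpec

namespace TorsorQuotient

variable {S : Scheme.{u}} {P O Q : Over S} (act pr₂ : P ⟶ O) (q : O ⟶ Q)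

/-! ## §1 The torsor quotient is a categorical quotient (Q5a) -/

/-- **CATEGORICAL QUOTIENT FROM A TORSOR SQUARE** (Q5a).  `q : O ⟶ Q` over `S` with `q.left` flat, surjective and quasi-compact (an fpqc cover), and the square
`P ⇉(act, pr₂) O →(q) Q` CARTESIAN on underlying schemes (the kernel pair of `q` is `(act, pr₂)` — for a free action of a finite flat group scheme, `P = G × O`,
[MumfordAV1970] §12 Thm. 1 (A)).  THEN every `f : O ⟶ W` over `S` with `act ≫ f = pr₂ ≫ f` factors UNIQUELY through `q` (fpqc descent of morphisms, ★
`Morphisms.existsUnique_desc_of_pullback_comp_eq`, after transporting the kernel-pair hypothesis along `P ≅ O ×_Q O`).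
[cite: MumfordAV1970, §12 Theorem 1 and its proof (pp. 111–115)] [cite: StacksProject, Tag 023Q] [cite: GortzWedhorn2020, Theorem 14.72] -/
theorem existsUnique_desc_of_isPullback [Flat q.left] [Surjective q.left] [QuasiCompact q.left]
    (hsq : IsPullback act.left pr₂.left q.left q.left) {W : Over S} (f : O ⟶ W) (hf : act ≫ f = pr₂ ≫ f) :
    ∃! g : Q ⟶ W, q ≫ g = f := by
  -- the kernel pair of `q.left` is `(act.left, pr₂.left)` up to the comparison isomorphism
  have e1 : hsq.isoPullback.hom ≫ pullback.fst q.left q.left = act.left := hsq.isoPullback_hom_fst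
  have e2 : hsq.isoPullback.hom ≫ pullback.snd q.left q.left = pr₂.left := hsq.isoPullback_hom_snd
  have hf' : act.left ≫ f.left = pr₂.left ≫ f.left := by rw [← Over.comp_left, ← Over.comp_left, hf]
  have hh : pullback.fst q.left q.left ≫ f.left = pullback.snd q.left q.left ≫ f.left := by
    rw [← cancel_epi hsq.isoPullback.hom, ← Category.assoc, ← Category.assoc, e1, e2, hf']
  obtain ⟨g₀, hg₀, huniq⟩ := Literature.AlgebraicGeometry.Morphisms.existsUnique_desc_of_pullback_comp_eq q.left f.left hh
  -- the descended morphism of schemes is over `S`: `q` is an epimorphism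
  haveI : Epi q.left := Flat.epi_of_flat_of_surjective q.left
  have hover : g₀ ≫ W.hom = Q.hom := by
    rw [← cancel_epi q.left, reassoc_of% hg₀, Over.w f, Over.w q]
  refine ⟨Over.homMk g₀ hover, Over.OverMorphism.ext (by change q.left ≫ g₀ = f.left; exact hg₀), fun g hg => ?_⟩
  apply Over.OverMorphism.ext
  change g.left = g₀
  exact huniq g.left (by change q.left ≫ g.left = f.left; rw [← Over.comp_left, hg])

/-- **Morphisms out of the quotient are determined after `q`** (`q.left` an fpqc cover, ★ `Morphisms.hom_ext_of_fpqc`). [cite: StacksProject, Tag 02VW]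
[cite: GortzWedhorn2020, Theorem 14.72] -/
theorem hom_ext [Flat q.left] [Surjective q.left] [QuasiCompact q.left] {W : Over S} {g₁ g₂ : Q ⟶ W} (h : q ≫ g₁ = q ≫ g₂) :
    g₁ = g₂ :=
  Over.OverMorphism.ext (Literature.AlgebraicGeometry.Morphisms.hom_ext_of_fpqc q.left
    (by rw [← Over.comp_left, ← Over.comp_left, h]))

/-- The descended morphism, composed with `q`, is `f` — and any `g` with `q ≫ g = f` IS the descended morphism (restatement of uniqueness for rewriting).
[cite: MumfordAV1970, §12 Theorem 1 and its proof (pp. 111–115)] -/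
theorem desc_unique [Flat q.left] [Surjective q.left] [QuasiCompact q.left]
    (hsq : IsPullback act.left pr₂.left q.left q.left) {W : Over S} (f : O ⟶ W) (hf : act ≫ f = pr₂ ≫ f) {g₁ g₂ : Q ⟶ W}
    (h₁ : q ≫ g₁ = f) (h₂ : q ≫ g₂ = f) : g₁ = g₂ :=
  (existsUnique_desc_of_isPullback act pr₂ q hsq f hf).unique h₁ h₂

/-! ## §2 Saturated (stable) opens descend (Q5b) -/

/-- **THE FIBRES OF `q` ARE THE `act`-IMAGES OF THE `pr₂`-FIBRES**: two points `x, w` of `O` with `q x = q w` are `x = act t`, `w = pr₂ t` for some point `t` of `P`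
(a point of the scheme `O ×_Q O` above `(x, w)` exists — Mathlib `Scheme.Pullback.exists_preimage_pullback` — and `P ≅ O ×_Q O`).
[cite: MumfordAV1970, §12 Theorem 1 and its proof (pp. 111–115)] -/
theorem exists_eq_act_eq_snd (hsq : IsPullback act.left pr₂.left q.left q.left) (x w : ↥O.left) (h : q.left.base x = q.left.base w) :
    ∃ t : ↥P.left, act.left.base t = x ∧ pr₂.left.base t = w := by
  obtain ⟨z, hz₁, hz₂⟩ := Scheme.Pullback.exists_preimage_pullback (f := q.left) (g := q.left) x w h
  refine ⟨hsq.isoPullback.inv.base z, ?_, ?_⟩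
  · have e := congrArg (fun k => k.base z) hsq.isoPullback_inv_fst
    simp only [Scheme.Hom.comp_base, TopCat.coe_comp, Function.comp_apply] at e
    rw [e]; exact hz₁
  · have e := congrArg (fun k => k.base z) hsq.isoPullback_inv_snd
    simp only [Scheme.Hom.comp_base, TopCat.coe_comp, Function.comp_apply] at e
    rw [e]; exact hz₂

/-- **A STABLE OPEN IS SATURATED**: for `W ⊆ O` with `act⁻¹ W = pr₂⁻¹ W` (as sets of points of `P`), `q⁻¹(q(W)) = W` ([MumfordAV1970] p. 112: the fibres of `q` are
the orbits). [cite: MumfordAV1970, §12 Theorem 1 and its proof (pp. 111–115)] [cite: SGA3I, Exp. V §5] -/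
theorem preimage_image_eq_of_stable (hsq : IsPullback act.left pr₂.left q.left q.left) (W : Set ↥O.left)
    (hW : act.left.base ⁻¹' W = pr₂.left.base ⁻¹' W) :
    q.left.base ⁻¹' (q.left.base '' W) = W := by
  refine Set.Subset.antisymm ?_ (Set.subset_preimage_image _ _)
  rintro x ⟨w, hw, hxw⟩
  obtain ⟨t, htx, htw⟩ := exists_eq_act_eq_snd act pr₂ q hsq x w hxw.symm
  have ht : t ∈ pr₂.left.base ⁻¹' W := by rw [Set.mem_preimage, htw]; exact hw
  rw [← hW, Set.mem_preimage, htx] at ht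
  exact ht

/-- **THE IMAGE OF A STABLE OPEN IS OPEN** when `q.left` is universally closed (e.g. finite) and surjective: `q(W) = Q ∖ q(O ∖ W)` because `W` is saturated,
and `q(O ∖ W)` is closed. [cite: MumfordAV1970, §12 Theorem 1 and its proof (pp. 111–115)] [cite: SGA3I, Exp. V §5] -/
theorem isOpen_image_of_stable [UniversallyClosed q.left] [Surjective q.left] (hsq : IsPullback act.left pr₂.left q.left q.left)
    (W : Set ↥O.left) (hWo : IsOpen W) (hW : act.left.base ⁻¹' W = pr₂.left.base ⁻¹' W) :
    IsOpen (q.left.base '' W) := by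
  have hsat := preimage_image_eq_of_stable act pr₂ q hsq W hW
  have hcompl : q.left.base '' W = (q.left.base '' Wᶜ)ᶜ := by
    ext y
    constructor
    · rintro ⟨w, hw, rfl⟩ ⟨x, hx, hxy⟩
      apply hx
      rw [← hsat, Set.mem_preimage, hxy]
      exact ⟨w, hw, rfl⟩
    · intro hy
      obtain ⟨x, rfl⟩ := q.left.surjective y
      by_contra hxW
      exact hy ⟨x, fun hx => hxW ⟨x, hx, rfl⟩, rfl⟩
  rw [hcompl, isOpen_compl_iff]
  exact q.left.isClosedMap _ hWo.isClosed_compl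

/-! ## §3 The restricted torsor square over an open of the quotient (ED. 2; the gluing step of [SGA3I] V §5) -/

/-- **THE TORSOR SQUARE RESTRICTS OVER ANY OPEN `U ⊆ Q`**: with `O_U := q⁻¹ U` and `P_U := act⁻¹ O_U` (`= pr₂⁻¹ O_U`), the square
`P_U ⇉(act, pr₂) O_U →(q ∣_ U) U` is again CARTESIAN (restriction of a cartesian square to opens — Mathlib `Scheme.Hom.isPullback_resLE`), and `q ∣_ U` is
again flat ∕ surjective ∕ finite ∕ quasi-compact (Mathlib instances for `morphismRestrict`), so §1–§2 re-apply to the quotient `O_U → U`.  For a STABLE open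
`W ⊆ O` take `U := q(W)` (open, §2) and `q⁻¹ U = W` (`preimage_imageOpens_eq_of_stable`): «`W → q(W)` is again an fppf torsor quotient».
[cite: SGA3I, Exp. V §5] [cite: MumfordAV1970, §12 Theorem 1 and its proof (pp. 111–115)] -/
theorem isPullback_resLE_of_isPullback (hsq : IsPullback act.left pr₂.left q.left q.left) (U : Q.left.Opens) :
    IsPullback (act.left ∣_ (q.left ⁻¹ᵁ U))
      (pr₂.left.resLE (q.left ⁻¹ᵁ U) (act.left ⁻¹ᵁ (q.left ⁻¹ᵁ U))
        (by rw [← Scheme.Hom.comp_preimage, hsq.w, Scheme.Hom.comp_preimage]))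
      (q.left ∣_ U) (q.left ∣_ U) := by
  have hUY : act.left ⁻¹ᵁ (q.left ⁻¹ᵁ U) = act.left ⁻¹ᵁ (q.left ⁻¹ᵁ U) ⊓ pr₂.left ⁻¹ᵁ (q.left ⁻¹ᵁ U) := by
    rw [← Scheme.Hom.comp_preimage, ← Scheme.Hom.comp_preimage, hsq.w, inf_idem]
  have h := Scheme.Hom.isPullback_resLE hsq (US := U) (UT := q.left ⁻¹ᵁ U) (UX := q.left ⁻¹ᵁ U) le_rfl le_rfl hUY
  rw [Scheme.Hom.resLE_eq_morphismRestrict, Scheme.Hom.resLE_eq_morphismRestrict] at h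
  exact h

/-- **A stable open is the preimage of its (open) image**, as OPENS of `O`: for `W` open and stable, `q⁻¹ᵁ ⟨q(W), _⟩ = W` (§2 on points).
[cite: SGA3I, Exp. V §5] [cite: MumfordAV1970, §12 Theorem 1 and its proof (pp. 111–115)] -/
theorem preimage_imageOpens_eq_of_stable [UniversallyClosed q.left] [Surjective q.left] (hsq : IsPullback act.left pr₂.left q.left q.left)
    (W : O.left.Opens) (hW : act.left.base ⁻¹' (W : Set ↥O.left) = pr₂.left.base ⁻¹' (W : Set ↥O.left)) :
    q.left ⁻¹ᵁ ⟨q.left.base '' (W : Set ↥O.left), isOpen_image_of_stable act pr₂ q hsq W W.isOpen hW⟩ = W := by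
  ext x
  change x ∈ q.left.base ⁻¹' (q.left.base '' (W : Set ↥O.left)) ↔ x ∈ (W : Set ↥O.left)
  rw [preimage_image_eq_of_stable act pr₂ q hsq W hW]

/-- **THE QUOTIENT OF A STABLE OPEN IS THE OPEN `q(W)`**: packaging of §3 for the gluing (census Q5c): the open `V := q(W)` of `Q` with `q⁻¹ V = W`, the
restricted map `q ∣_ V : W → V` flat, surjective and universally closed, and the restricted cartesian square `act⁻¹ W ⇉ W → V`.
[cite: SGA3I, Exp. V §5] [cite: MumfordAV1970, §12 Theorem 1 and its proof (pp. 111–115)] -/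
theorem exists_opens_quotient_of_stable [Flat q.left] [UniversallyClosed q.left] [Surjective q.left]
    (hsq : IsPullback act.left pr₂.left q.left q.left) (W : O.left.Opens)
    (hW : act.left.base ⁻¹' (W : Set ↥O.left) = pr₂.left.base ⁻¹' (W : Set ↥O.left)) :
    ∃ (V : Q.left.Opens) (_ : q.left ⁻¹ᵁ V = W),
      (V : Set ↥Q.left) = q.left.base '' (W : Set ↥O.left) ∧ Flat (q.left ∣_ V) ∧ Surjective (q.left ∣_ V) ∧ UniversallyClosed (q.left ∣_ V) ∧
      IsPullback (act.left ∣_ (q.left ⁻¹ᵁ V))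
        (pr₂.left.resLE (q.left ⁻¹ᵁ V) (act.left ⁻¹ᵁ (q.left ⁻¹ᵁ V))
          (by rw [← Scheme.Hom.comp_preimage, hsq.w, Scheme.Hom.comp_preimage]))
        (q.left ∣_ V) (q.left ∣_ V) := by
  refine ⟨⟨q.left.base '' (W : Set ↥O.left), isOpen_image_of_stable act pr₂ q hsq W W.isOpen hW⟩,
    preimage_imageOpens_eq_of_stable act pr₂ q hsq W hW, rfl, ?_, ?_, ?_, isPullback_resLE_of_isPullback act pr₂ q hsq _⟩
  · exact IsZariskiLocalAtTarget.restrict ‹Flat q.left› _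
  · exact IsZariskiLocalAtTarget.restrict ‹Surjective q.left› _
  · exact IsZariskiLocalAtTarget.restrict ‹UniversallyClosed q.left› _

end TorsorQuotient

end Literature.AlgebraicGeometry.RelativeSpec

end
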